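import Mathlib
import HarnessLib

/-!
# Crux `NewtonUnitEquations.DissociatedUniform` (stmt-ValiantsHypothesis-5905), `n = 3` totals law of model (Q**):
# EXCHANGE INEQUALITIES FOR CLASS-HULL EDGES (two co-maximal words of one class)

A hull EDGE of the class `s` with outer normal `w` is a pair of words `W = (x,y,z)`, `W' = (x',y',z')` of class `s` that both attain
the class maximum of the weight `⟨w, ·⟩`; writing `α = ⟨w, a ·⟩`, `β = ⟨w, b ·⟩`, `γ = ⟨w, c ·⟩` this is a statement about three real
sequences on the label group.  The census of this seat (memo NOTES-t1g15 §3) sorts the edges by the letters the two words share: a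
shared third letter (`W' = (x+d, y−d, z)`: a translate by `c z` of an edge of the fibre `P_{x+y}`), a shared first / second letter, or
none ("hexagon").  This file records the local necessary conditions such a pair forces on the THIRD sequence (pure bookkeeping over an
additive commutative group, no geometry):
* `sandwich_of_coMax_shared_third` — if `(x,y,z)` and `(x+d,y−d,z)` are both class maxima then
  `γ z − γ (z − d) ≥ μ ≥ γ (z + d) − γ z` with `μ = α (x+d) − α x` (compare with `(x+d, y, z−d)` and `(x, y−d, z+d)`): the classes exposing
  a given fibre edge sit at DOWN-CROSSINGS of the level `μ` by the `d`-increments of `γ` — which is why every fibre edge is exposed in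
  exactly one class on all convexly ordered census families, and why 'edge conservation' can only hold up to constants in general;
* `hexagon_exchange` — if `(x,y,z)` and `(x+u, y+v, z−u−v)` are both class maxima, the six one-letter-kept competitors give six
  inequalities coupling the `u`- and `v`-increments of `α, β, γ` (mixed second differences have a sign).
Honest label: elementary tools for the edge/letter-switch form of the law (`LetterSwitchLaw`, memo §3); no law is proved here; nothing
bears on VP ≠ VNP.
[folklore: exchange arguments for separable objectives]
-/

set_option linter.dupNamespace false -- `ValiantsHypothesis.ValiantsHypothesis` (summit = problem) in every name

namespace Summit.ValiantsHypothesis.ValiantsHypothesis.Theorems.NewtonUnitEquationsDissociatedUniform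

namespace TotalsLaw

variable {G : Type*} [AddCommGroup G]

/-- **Sandwich (shared third letter).**  If `(x, y, z)` and `(x + d, y - d, z)` both attain a class bound `M` of their class, then the
`d`-increments of `γ` around `z` sandwich `μ = α (x + d) − α x`:  `γ z − γ (z − d) ≥ μ ≥ γ (z + d) − γ z`. [folklore] -/
theorem sandwich_of_coMax_shared_third {α β γ : G → ℝ} {s : G} {M : ℝ} (hM : ∀ x' y' z' : G, x' + y' + z' = s → α x' + β y' + γ z' ≤ M) {x y z d : G}
    (hs : x + y + z = s) (h₁ : α x + β y + γ z = M) (h₂ : α (x + d) + β (y - d) + γ z = M) :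
    α (x + d) - α x ≤ γ z - γ (z - d) ∧ γ (z + d) - γ z ≤ α (x + d) - α x := by
  constructor
  · -- competitor `(x + d, y, z - d)`
    have h := hM (x + d) y (z - d) (by rw [← hs]; abel)
    linarith
  · -- competitor `(x, y - d, z + d)`
    have h := hM x (y - d) (z + d) (by rw [← hs]; abel)
    linarith

/-- The same sandwich read on the second sequence: `β y − β (y − d) = μ` is forced too (the two maxima are equal), so
`β y − β (y − d) ≤ γ z − γ (z − d)` and `γ (z + d) − γ z ≤ β y − β (y − d)`. [folklore] -/
theorem sandwich_of_coMax_shared_third' {α β γ : G → ℝ} {s : G} {M : ℝ} (hM : ∀ x' y' z' : G, x' + y' + z' = s → α x' + β y' + γ z' ≤ M) {x y z d : G}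
    (hs : x + y + z = s) (h₁ : α x + β y + γ z = M) (h₂ : α (x + d) + β (y - d) + γ z = M) :
    β y - β (y - d) ≤ γ z - γ (z - d) ∧ γ (z + d) - γ z ≤ β y - β (y - d) := by
  have hμ : α (x + d) - α x = β y - β (y - d) := by linarith
  have h := sandwich_of_coMax_shared_third hM hs h₁ h₂
  rw [hμ] at h
  exact h

/-- **No two exposing classes differ by the transfer.**  If `(x,y,z)`, `(x+d,y−d,z)` attain the bound of class `s` and
`(x,y,z+d)`, `(x+d,y−d,z+d)` attain the bound of class `s + d`, then all four sandwich inequalities are equalities — in particular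
`γ (z + d) − γ z = α (x + d) − α x` (a non-generic coincidence). [folklore] -/
theorem increment_eq_of_coMax_two_classes {α β γ : G → ℝ} {s : G} {M M' : ℝ} {x y z d : G}
    (hM : ∀ x' y' z' : G, x' + y' + z' = s → α x' + β y' + γ z' ≤ M)
    (hM' : ∀ x' y' z' : G, x' + y' + z' = s + d → α x' + β y' + γ z' ≤ M') (hs : x + y + z = s)
    (h₁ : α x + β y + γ z = M)
    (h₂ : α (x + d) + β (y - d) + γ z = M) (h₁' : α x + β y + γ (z + d) = M')
    (h₂' : α (x + d) + β (y - d) + γ (z + d) = M') : γ (z + d) - γ z = α (x + d) - α x := by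
  have hA := (sandwich_of_coMax_shared_third hM hs h₁ h₂).2
  have hs' : x + y + (z + d) = s + d := by rw [← hs]; abel
  have hB := (sandwich_of_coMax_shared_third hM' hs' h₁' h₂').1
  rw [add_sub_cancel_right] at hB
  linarith

/-- **Hexagon exchange (no shared letter).**  If `W = (x, y, z)` and `W' = (x + u, y + v, z − u − v)` both attain a class bound,
the six competitors keeping one letter of `W` or `W'` give, with `μ_a = α (x+u) − α x` and `μ_b = β (y+v) − β y`:
`μ_b ≤ γ z − γ (z − v)`, `μ_a ≤ γ z − γ (z − u)`, `β (y+u+v) − β (y+v) ≤ μ_a`, `μ_a ≤ β y − β (y − u)`,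
`α (x+u+v) − α (x+u) ≤ μ_b`, `μ_b ≤ α x − α (x − v)`. [folklore] -/
theorem hexagon_exchange {α β γ : G → ℝ} {s : G} {M : ℝ} (hM : ∀ x' y' z' : G, x' + y' + z' = s → α x' + β y' + γ z' ≤ M) {x y z u v : G}
    (hs : x + y + z = s) (h₁ : α x + β y + γ z = M) (h₂ : α (x + u) + β (y + v) + γ (z - u - v) = M) :
    β (y + v) - β y ≤ γ z - γ (z - v) ∧ α (x + u) - α x ≤ γ z - γ (z - u) ∧
      β (y + u + v) - β (y + v) ≤ α (x + u) - α x ∧ α (x + u) - α x ≤ β y - β (y - u) ∧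
      α (x + u + v) - α (x + u) ≤ β (y + v) - β y ∧ β (y + v) - β y ≤ α x - α (x - v) := by
  refine ⟨?_, ?_, ?_, ?_, ?_, ?_⟩
  · have h := hM x (y + v) (z - v) (by rw [← hs]; abel); linarith
  · have h := hM (x + u) y (z - u) (by rw [← hs]; abel); linarith
  · have h := hM x (y + u + v) (z - u - v) (by rw [← hs]; abel); linarith
  · have h := hM (x + u) (y - u) z (by rw [← hs]; abel); linarith
  · have h := hM (x + u + v) y (z - u - v) (by rw [← hs]; abel); linarith
  · have h := hM (x - v) (y + v) z (by rw [← hs]; abel); linarith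

/-- Consequence of the hexagon exchange: the mixed second differences are signed,
`[γ z − γ (z−u)] − [γ (z−v) − γ (z−u−v)] ≥ 0`, `[β y − β (y−u)] − [β (y+v) − β (y+v−u)]≥ 0` in the form
`β (y+u+v) − β (y+v) ≤ β y − β (y−u)`, and `α (x+u+v) − α (x+u) ≤ α x − α (x−v)`. [folklore] -/
theorem hexagon_mixed_differences {α β γ : G → ℝ} {s : G} {M : ℝ} (hM : ∀ x' y' z' : G, x' + y' + z' = s → α x' + β y' + γ z' ≤ M) {x y z u v : G}
    (hs : x + y + z = s) (h₁ : α x + β y + γ z = M) (h₂ : α (x + u) + β (y + v) + γ (z - u - v) = M) :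
    γ (z - v) - γ (z - u - v) ≤ γ z - γ (z - u) ∧ β (y + u + v) - β (y + v) ≤ β y - β (y - u) ∧
      α (x + u + v) - α (x + u) ≤ α x - α (x - v) := by
  obtain ⟨e1, e2, e3, e4, e5, e6⟩ := hexagon_exchange hM hs h₁ h₂
  refine ⟨?_, e3.trans e4, e5.trans e6⟩
  -- `μ_a + μ_b = γ z − γ (z − u − v)` from the two maxima; combine with `e1`… via the competitor `(x + u, y, z − u)` read at `W'`
  have hsum : (α (x + u) - α x) + (β (y + v) - β y) = γ z - γ (z - u - v) := by linarith
  -- competitor `(x + u, y, z - u)` vs `W'`: `β (y+v) − β y ≥ γ (z − u) − γ (z − u − v)`; with `e1` read for `W'`… use `hM` directly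
  have h := hM (x + u) y (z - u) (by rw [← hs]; abel)
  -- h : α (x+u) + β y + γ (z-u) ≤ M = α (x+u) + β (y+v) + γ (z-u-v)
  have h' : γ (z - u) - γ (z - u - v) ≤ β (y + v) - β y := by linarith
  linarith [e1, h', hsum]

end TotalsLaw

end Summit.ValiantsHypothesis.ValiantsHypothesis.Theorems.NewtonUnitEquationsDissociatedUniform
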